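import Summits.BirchSwinnertonDyer.BirchSwinnertonDyer.Theorems.ErratumRoadFiveShimuraKolyvaginOrderBoundInertShiftEnd
import Literature.NumberTheory.EllipticCurves.HeightsProofs
import Literature.NumberTheory.EllipticCurves.ModularDegreeFormulaProofs
import Literature.NumberTheory.EllipticCurves.HeegnerPoints
import HarnessLib

/-!
# Route `ErratumRoadFive`, crux `ShimuraKolyvaginOrderBoundInertFromFive` (item
# stmt-BirchSwinnertonDyer-19718) — the HEIGHT TRANSFER: from the carrier's bottom point `y` to EVERY
# displayed point `P` of the crux, and S1's shape from a DISPLAYED depth-`k` carrier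

Cell `bsd-stepL`, seat `bsd-stepL-shim-p1` (prover g8), HELPER for the crux
`Summit.BirchSwinnertonDyer.BirchSwinnertonDyer.Theses.ErratumRoadFive.ShimuraKolyvaginOrderBoundInertFromFive`
(`--supports stmt-BirchSwinnertonDyer-19718 --as helper`; K2 route `route-BirchSwinnertonDyer-ErratumRoadFive`
rev 19; skeleton v2 df9d5864b1b31f6b, stub S1 `stub_inert_unitIndex`). Sequel of `…InertShiftEnd` (p482014: S1's
`Nat.card` shape WITHOUT `hTam` from the depth-`k` ring-class-rational carrier with bottom point `P`).

## Why

S1 quantifies over EVERY non-torsion `P ∈ E(K)` carrying the Cai–Shu–Tian Gross–Zagier display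
`L'(E/K,1) = C(f,K) · ĥ(P)/degS` with `v_p(degS) = v_p(deg P₀)`, whereas a Heegner-point Euler system has
ONE bottom point `y` (the trace of the CM point). The two are bridged by elementary height algebra once
`ℤy` has finite index in `E(K)` (Kolyvagin's rank statement for `y`, printed and supplier-carried per
planner g28): `[E(K):ℤy] • P = a • y`, `[E(K):ℤP] = |a|` (§1), `[E(K):ℤy]² ĥ(P) = a² ĥ(y)` (Néron–Tate
quadraticity, §2), and the two displays with the same constant `C(f,K) ≠ 0` (Petersson norm `> 0`,
Zagier; §3) give `[E(K):ℤy]²·degS_P = [E(K):ℤP]²·degS_y`, whence `v_p[E(K):ℤP] = v_p[E(K):ℤy]` when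
`v_p(degS_P) = v_p(degS_y)` (§4). So S1 for every displayed `P` follows from the machine's conclusion at
the carrier's own displayed bottom point `y` (§5).

## What is proved (theorems only; no `def`, no named fact, no `sorry`)

* §1 `relIndex_zmultiples_zsmul`, `index_zmultiples_eq_natAbs_of_nsmul_index_eq_zsmul`,
  `not_isOfFinAddOrder_of_index_pos` — index bookkeeping in an abelian group.
* §2 `sq_mul_canonicalHeight_eq_of_nsmul_eq_zsmul` — `n² ĥ(P) = a² ĥ(y)` from `nP = ay`.
* §3 `grossZagierConstant_ne_zero` — `8π²(f,f)/((w_K/2)²√|d_K|) ≠ 0`.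
* §4 **`padicValNat_index_eq_of_displays`** — for displayed non-torsion `P`, `y` with `0 < [E(K):ℤy]` and
  `v_p(degS_P) = v_p(degS_y)`: `0 < [E(K):ℤP]` and `v_p[E(K):ℤP] = v_p[E(K):ℤy]`.
* §5 **`natCard_primaryComponent_sha_le_of_displayedCarrier_shift_of_poitouTate`** — S1's CONCLUSION
  for the crux's `P` from a DISPLAYED depth-`k` carrier: a point `y ∈ E(K)` with its own display and
  `0 < [E(K):ℤy]`, carrying `hpointsRk` (p482014 §2) with bottom `y`; plus `hPT`. The guard `0 < index` and
  the bottom point now sit on the SUPPLIER's side, as ruled (plan g28 (1)).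

HONEST FRAMING: S1 `stub_inert_unitIndex` and item 19718 stay OPEN; the gap to S1 as registered is now
exactly ONE supplier statement — a displayed Shimura–Heegner point `y ∈ E(K)` of finite index carrying the
depth-`k` ring-class-rational Euler system (printed: CST14 Thm 1.5 + BD96 §2 + Nekovář 2007 §4 + Kolyvagin's
rank theorem on `X_{N⁺,N⁻}`) — and `hPT ∈ PublishedInputsFive`. BSD is not proved by any of this; no census
number moves. [cite: SilvermanAEC2009, Thm. VIII.9.3 (b), (d)] [cite: ZagierCMB1985, §1]
[cite: CaiShuTian2014, Thm. 1.5] [cite: GrossLMS1991, Prop. 2.1 (2)] [cite: McCallumLMS1991, §1, Lemma 5.1]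
[cite: Kim2022HigherGZ, §2.1 and Thm. 4.3]
presearch: «index comparison of two points with Gross–Zagier displays ∕ heights on a rank-one group» →
elementary (Silverman VIII.9.3); [corpus: paper:arxiv-1408.1733 CST14 p0007 Thm 1.5] for the display;
`lean search 'index_eq_of_displays|displayedCarrier'` → none.
-/

noncomputable section

open scoped Classical

set_option linter.dupNamespace false

namespace Summit.BirchSwinnertonDyer.BirchSwinnertonDyer.Theorems

open WeierstrassCurve NumberField IsDedekindDomain Field
  Literature.NumberTheory.EllipticCurves Literature.NumberTheory.GaloisRepresentations
  Literature.NumberTheory.GaloisCohomology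
  Literature.NumberTheory.EllipticCurves.RingClassField

/-! ### §1 Index bookkeeping in an abelian group -/

section Index

variable {G : Type*} [AddCommGroup G]

/-- For `y` of infinite order and `a : ℤ`, `[ℤy : ℤ(a•y)] = |a|` (pull back along `ℤ → ℤy`, then
`[ℤ : aℤ] = |a|`). [folklore] -/
theorem relIndex_zmultiples_zsmul {y : G} (hy : ¬ IsOfFinAddOrder y) (a : ℤ) :
    (AddSubgroup.zmultiples (a • y)).relIndex (AddSubgroup.zmultiples y) = a.natAbs := by
  set H := AddSubgroup.zmultiples (a • y) with hH
  have h2 : H.relIndex (AddSubgroup.zmultiples y) = (H.comap (zmultiplesHom G y)).index := by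
    rw [← AddSubgroup.range_zmultiplesHom, AddMonoidHom.range_eq_map, ← AddSubgroup.relIndex_comap,
      AddSubgroup.relIndex_top_right]
  rw [h2]
  have hinj : Function.Injective fun n : ℤ ↦ n • y := injective_zsmul_iff_not_isOfFinAddOrder.mpr hy
  have h3 : H.comap (zmultiplesHom G y) = AddSubgroup.zmultiples a := by
    ext n
    rw [AddSubgroup.mem_comap, hH, AddSubgroup.mem_zmultiples_iff, AddSubgroup.mem_zmultiples_iff]
    constructor
    · rintro ⟨m, hm⟩
      refine ⟨m, hinj ?_⟩
      change (m • a) • y = n • y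
      rw [smul_eq_mul, mul_smul, hm, zmultiplesHom_apply]
    · rintro ⟨m, rfl⟩
      refine ⟨m, ?_⟩
      rw [zmultiplesHom_apply, smul_eq_mul, mul_smul]
  rw [h3, Int.index_zmultiples]

/-- **`[G : ℤP] = |a|` when `[G:ℤy] • P = a • y`** for `P` of infinite order and `ℤy` of finite index
`n = [G : ℤy] > 0`: both `[G : ℤ(nP)] = n·[G : ℤP]` and `[G : ℤ(ay)] = |a|·n` compute the index of the
same subgroup. In particular `[G : ℤP]` is finite and positive (`a ≠ 0`). [folklore] -/
theorem index_zmultiples_eq_natAbs_of_nsmul_index_eq_zsmul {P y : G} (hP : ¬ IsOfFinAddOrder P)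
    (hy : ¬ IsOfFinAddOrder y) (hn : 0 < (AddSubgroup.zmultiples y).index) {a : ℤ}
    (ha : (AddSubgroup.zmultiples y).index • P = a • y) :
    (AddSubgroup.zmultiples P).index = a.natAbs := by
  set n := (AddSubgroup.zmultiples y).index with hndef
  -- the common subgroup `ℤ(nP) = ℤ(ay)`
  have hHP : AddSubgroup.zmultiples ((n : ℤ) • P) ≤ AddSubgroup.zmultiples P :=
    AddSubgroup.zmultiples_le_of_mem (AddSubgroup.zsmul_mem _ (AddSubgroup.mem_zmultiples P) _)
  have hHy : AddSubgroup.zmultiples (a • y) ≤ AddSubgroup.zmultiples y :=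
    AddSubgroup.zmultiples_le_of_mem (AddSubgroup.zsmul_mem _ (AddSubgroup.mem_zmultiples y) _)
  have heq : AddSubgroup.zmultiples ((n : ℤ) • P) = AddSubgroup.zmultiples (a • y) := by
    rw [natCast_zsmul, ha]
  have h1 := AddSubgroup.relIndex_mul_index hHP
  have h2 := AddSubgroup.relIndex_mul_index hHy
  rw [relIndex_zmultiples_zsmul hP, Int.natAbs_natCast] at h1
  rw [relIndex_zmultiples_zsmul hy, ← heq, ← h1, ← hndef] at h2
  -- `|a| * n = n * [G : ℤP]`
  have h3 : n * (AddSubgroup.zmultiples P).index = n * a.natAbs := by rw [← h2, mul_comm]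
  exact Nat.eq_of_mul_eq_mul_left hn h3

/-- If `ℤy` has finite (positive) index and `G` has an element `P` of infinite order, then `y` has
infinite order (else `G` would be torsion). [folklore] -/
theorem not_isOfFinAddOrder_of_index_pos {P y : G} (hP : ¬ IsOfFinAddOrder P)
    (hn : 0 < (AddSubgroup.zmultiples y).index) : ¬ IsOfFinAddOrder y := by
  intro hy
  apply hP
  have hmem : (AddSubgroup.zmultiples y).index • P ∈ AddSubgroup.zmultiples y :=
    (AddSubgroup.zmultiples y).nsmul_index_mem P
  obtain ⟨a, ha⟩ := AddSubgroup.mem_zmultiples_iff.mp hmem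
  obtain ⟨m, hm, hmy⟩ := (isOfFinAddOrder_iff_nsmul_eq_zero).mp hy
  refine (isOfFinAddOrder_iff_nsmul_eq_zero).mpr ⟨m * (AddSubgroup.zmultiples y).index,
    Nat.mul_pos hm hn, ?_⟩
  rw [mul_comm, mul_nsmul, ← ha, smul_comm, hmy, smul_zero]

end Index

/-! ### §2 Néron–Tate quadraticity: `n² ĥ(P) = a² ĥ(y)` from `nP = ay` -/

/-- **`n² ĥ(P) = a² ĥ(y)` when `n • P = a • y`** (`ĥ(mQ) = m² ĥ(Q)`, Silverman VIII.9.3 (b); tree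
`canonicalHeight_nsmul_holds`, `canonicalHeight_zsmul_holds`). [cite: SilvermanAEC2009, Thm. VIII.9.3 (b)] -/
theorem sq_mul_canonicalHeight_eq_of_nsmul_eq_zsmul {F : Type*} [Field F] [NumberField F]
    {V : WeierstrassCurve F} [V.IsElliptic] {P y : V.toAffine.Point} {n : ℕ} {a : ℤ}
    (h : n • P = a • y) :
    (n : ℝ) ^ 2 * P.canonicalHeight = (a : ℝ) ^ 2 * y.canonicalHeight := by
  rw [← WeierstrassCurve.Affine.Point.canonicalHeight_nsmul_holds n P,
    ← WeierstrassCurve.Affine.Point.canonicalHeight_zsmul_holds a y, h]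

/-! ### §3 The Gross–Zagier constant of the display is non-zero -/

/-- **The constant `C(f,K) = 8π²(f,f)/((w_K/2)²√|d_K|)` of the Cai–Shu–Tian ∕ Gross–Zagier display is
non-zero**: `(f,f)` has positive real part (Zagier's degree formula, tree
`zagier_degree_formula.peterssonProduct_re_pos` with `zagier_degree_formula_holds`), `w_K ≥ 1`, `d_K ≠ 0`.
[cite: ZagierCMB1985, §1 (p. 374)] -/
theorem grossZagierConstant_ne_zero (W : WeierstrassCurve ℚ) [W.IsElliptic] {N : ℕ} [NeZero N]
    (Dt : Literature.NumberTheory.EllipticCurves.ModularForms.ModularParametrizationData W N)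
    (K : Type) [Field K] [NumberField K] :
    (8 * (Real.pi : ℂ) ^ 2 *
        Literature.NumberTheory.EllipticCurves.ModularForms.peterssonProduct (CongruenceSubgroup.Gamma0 N) 2
          Dt.f Dt.f /
        ((((NumberField.Units.torsionOrder K : ℝ) / 2) ^ 2 * √|(NumberField.discr K : ℝ)| : ℝ) : ℂ)) ≠ 0 := by
  have hpp : Literature.NumberTheory.EllipticCurves.ModularForms.peterssonProduct
      (CongruenceSubgroup.Gamma0 N) 2 Dt.f Dt.f ≠ 0 := by
    intro h
    have hre := Literature.NumberTheory.EllipticCurves.ModularForms.ModularParametrizationData.zagier_degree_formula.peterssonProduct_re_pos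
      Dt.zagier_degree_formula_holds
    rw [h, Complex.zero_re] at hre
    exact lt_irrefl _ hre
  have hπ : (Real.pi : ℂ) ≠ 0 := Complex.ofReal_ne_zero.mpr Real.pi_ne_zero
  have hw : (0 : ℝ) < (NumberField.Units.torsionOrder K : ℝ) := by
    exact_mod_cast NumberField.Units.torsionOrder_pos K
  have hd : (0 : ℝ) < √|(NumberField.discr K : ℝ)| :=
    Real.sqrt_pos.mpr (abs_pos.mpr (by exact_mod_cast NumberField.discr_ne_zero K))
  have hden : ((((NumberField.Units.torsionOrder K : ℝ) / 2) ^ 2 * √|(NumberField.discr K : ℝ)| : ℝ) : ℂ) ≠ 0 := by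
    rw [Complex.ofReal_ne_zero]
    positivity
  have h8 : (8 : ℂ) ≠ 0 := by norm_num
  exact div_ne_zero (mul_ne_zero (mul_ne_zero h8 (pow_ne_zero 2 hπ)) hpp) hden

/-! ### §4 Two displayed points: `0 < [E(K):ℤP]` and `v_p[E(K):ℤP] = v_p[E(K):ℤy]` -/

/-- **Height transfer between two displayed points.** `E = W/ℚ` with a modular parametrisation datum
`Dt` of level `N`, `K` a number field, `P, y ∈ E(K)` with `P` of infinite order and `ℤy` of finite index,
both DISPLAYED — `L'(E/K,1) = C(f,K)·ĥ(P)/degS_P = C(f,K)·ĥ(y)/degS_y` with `degS_P, degS_y > 0` and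
`v_p(degS_P) = v_p(degS_y)`. Then `ℤP` has finite index too and `v_p[E(K):ℤP] = v_p[E(K):ℤy]`. Proof:
`[E(K):ℤy]•P = a•y` (the index kills the quotient), `[E(K):ℤP] = |a|` (§1), `[E(K):ℤy]² ĥ(P) = a² ĥ(y)`
(§2), `ĥ(P)/degS_P = ĥ(y)/degS_y` (`C ≠ 0`, §3), `ĥ(y) ≠ 0` (`y` non-torsion, Silverman VIII.9.3 (d)), so
`[E(K):ℤy]²·degS_P = [E(K):ℤP]²·degS_y` in `ℕ` and the `p`-adic valuations agree.
[cite: SilvermanAEC2009, Thm. VIII.9.3 (b), (d)] [cite: CaiShuTian2014, Thm. 1.5] -/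
theorem padicValNat_index_eq_of_displays (W : WeierstrassCurve ℚ) [W.IsElliptic] {N : ℕ} [NeZero N]
    (Dt : Literature.NumberTheory.EllipticCurves.ModularForms.ModularParametrizationData W N)
    (K : Type) [Field K] [NumberField K] (p : ℕ) [Fact p.Prime]
    {P y : (W.baseChange K).toAffine.Point} (hP : ¬ IsOfFinAddOrder P)
    (hy : 0 < (AddSubgroup.zmultiples y).index) {degP degy : ℕ} (h0P : 0 < degP) (h0y : 0 < degy)
    (hv : padicValNat p degP = padicValNat p degy)
    (hLP : Literature.NumberTheory.EllipticCurves.LDerivEK W K = 8 * (Real.pi : ℂ) ^ 2 *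
      Literature.NumberTheory.EllipticCurves.ModularForms.peterssonProduct (CongruenceSubgroup.Gamma0 N) 2
        Dt.f Dt.f / ((((NumberField.Units.torsionOrder K : ℝ) / 2) ^ 2 * √|(NumberField.discr K : ℝ)| : ℝ) : ℂ) *
      ((P.canonicalHeight : ℂ) / (degP : ℂ)))
    (hLy : Literature.NumberTheory.EllipticCurves.LDerivEK W K = 8 * (Real.pi : ℂ) ^ 2 *
      Literature.NumberTheory.EllipticCurves.ModularForms.peterssonProduct (CongruenceSubgroup.Gamma0 N) 2
        Dt.f Dt.f / ((((NumberField.Units.torsionOrder K : ℝ) / 2) ^ 2 * √|(NumberField.discr K : ℝ)| : ℝ) : ℂ) *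
      ((y.canonicalHeight : ℂ) / (degy : ℂ))) :
    0 < (AddSubgroup.zmultiples P).index ∧
      padicValNat p (AddSubgroup.zmultiples P).index = padicValNat p (AddSubgroup.zmultiples y).index := by
  haveI : (W.baseChange K).IsElliptic := inferInstanceAs (W.map (algebraMap ℚ K)).IsElliptic
  have hp : p.Prime := Fact.out
  set n := (AddSubgroup.zmultiples y).index with hndef
  -- `y` has infinite order, `nP = ay`, `[E(K):ℤP] = |a|`
  have hy' : ¬ IsOfFinAddOrder y := not_isOfFinAddOrder_of_index_pos hP hy
  obtain ⟨a, ha⟩ := AddSubgroup.mem_zmultiples_iff.mp ((AddSubgroup.zmultiples y).nsmul_index_mem P)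
  have ha' : n • P = a • y := ha.symm
  have hidx : (AddSubgroup.zmultiples P).index = a.natAbs :=
    index_zmultiples_eq_natAbs_of_nsmul_index_eq_zsmul hP hy' hy ha'
  have ha0 : a ≠ 0 := by
    rintro rfl
    rw [zero_smul] at ha'
    exact hP ((isOfFinAddOrder_iff_nsmul_eq_zero).mpr ⟨n, hy, ha'⟩)
  have hidx0 : 0 < (AddSubgroup.zmultiples P).index := by
    rw [hidx]; exact Int.natAbs_pos.mpr ha0
  refine ⟨hidx0, ?_⟩
  -- heights: `n² ĥ(P) = a² ĥ(y)` and `ĥ(P)/degP = ĥ(y)/degy`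
  have hsq := sq_mul_canonicalHeight_eq_of_nsmul_eq_zsmul ha'
  have hC := grossZagierConstant_ne_zero W Dt K
  have hdisp : (P.canonicalHeight : ℂ) / (degP : ℂ) = (y.canonicalHeight : ℂ) / (degy : ℂ) :=
    mul_left_cancel₀ hC (hLP.symm.trans hLy)
  have hdispR : P.canonicalHeight / degP = y.canonicalHeight / degy := by
    have h := congrArg Complex.re hdisp
    simpa [← Complex.ofReal_natCast, ← Complex.ofReal_div] using h
  have hhy : y.canonicalHeight ≠ 0 := fun h ↦
    hy' ((WeierstrassCurve.Affine.Point.canonicalHeight_eq_zero_iff_holds y).mp h)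
  have hdegP : (degP : ℝ) ≠ 0 := by exact_mod_cast h0P.ne'
  have hdegy : (degy : ℝ) ≠ 0 := by exact_mod_cast h0y.ne'
  -- `n² degP = a² degy` in `ℝ`, then in `ℕ`
  rw [div_eq_div_iff hdegP hdegy] at hdispR
  -- hdispR : ĥ(P) * degy = ĥ(y) * degP
  have e1 : (n : ℝ) ^ 2 * (P.canonicalHeight * degy) = (a : ℝ) ^ 2 * y.canonicalHeight * degy := by
    rw [← mul_assoc, hsq]
  rw [hdispR] at e1
  have hreal : ((n : ℝ) ^ 2 * degP) * y.canonicalHeight = ((a : ℝ) ^ 2 * degy) * y.canonicalHeight := by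
    calc ((n : ℝ) ^ 2 * degP) * y.canonicalHeight = (n : ℝ) ^ 2 * (y.canonicalHeight * degP) := by ring
      _ = (a : ℝ) ^ 2 * y.canonicalHeight * degy := e1
      _ = ((a : ℝ) ^ 2 * degy) * y.canonicalHeight := by ring
  have hreal' : (n : ℝ) ^ 2 * degP = (a : ℝ) ^ 2 * degy := mul_right_cancel₀ hhy hreal
  have hnat : n ^ 2 * degP = a.natAbs ^ 2 * degy := by
    have h1 : ((a.natAbs : ℕ) : ℝ) ^ 2 = (a : ℝ) ^ 2 := by
      have h := congrArg (fun z : ℤ ↦ (z : ℝ)) (Int.natAbs_sq a)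
      simp only [Int.cast_pow, Int.cast_natCast] at h
      exact h
    have h2 : ((n ^ 2 * degP : ℕ) : ℝ) = ((a.natAbs ^ 2 * degy : ℕ) : ℝ) := by
      push_cast
      rw [h1]
      exact hreal'
    exact_mod_cast h2
  -- valuations
  have hval := congrArg (padicValNat p) hnat
  rw [padicValNat.mul (pow_ne_zero 2 hy.ne') h0P.ne', padicValNat.mul (pow_ne_zero 2
      (Int.natAbs_pos.mpr ha0).ne') h0y.ne', padicValNat.pow, padicValNat.pow, hv] at hval
  rw [hidx]
  omega

/-! ### §5 S1's `Nat.card` shape from a DISPLAYED depth-`k` carrier and Poitou–Tate — for EVERY displayed `P` -/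

/-- **S1's conclusion `#Ш(E/K)[p^∞] ≤ p^{2·ord_p[E(K):ℤP]}` (here `= 1`) for the crux's displayed point `P`,
from a DISPLAYED depth-`k` ring-class-rational carrier.** Binders: the crux's (`W` globally minimal of
conductor `N` with modular parametrisation datum `Dt`, `[Fact p.Prime]`, `5 ≤ p`, `ρ̄_{E,p}` onto, `K`
imaginary quadratic, `hin`, `hsp`; `P ∈ E(K)` non-torsion with its Cai–Shu–Tian display `hL` at `degS > 0`
and `padicValNat p [E(K):ℤP] = 0`) + `ι : K → ℂ`; the SUPPLIER's data: a point `y ∈ E(K)` with its own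
display at `degy > 0`, `v_p(degS) = v_p(degy)` (both `= v_p(deg P₀)` in the crux), `0 < [E(K):ℤy]`
(Kolyvagin's rank statement for the Heegner point — printed, supplier-carried), and the depth-`k`
ring-class-rational Euler system `hpointsRk` of `…InertShiftEnd` §2 with bottom point `y`; plus `hPT`
(Poitou–Tate, conjunct 14 of `PublishedInputsFive`, cite-only ⇒ CONDITIONAL on it). Proof: §4 transfers
`0 < index` and `v_p(index) = 0` from `P` to `y`; `…InertShiftEnd` §3 at `y`. HONEST: S1 stays OPEN; its
gap is now ONE supplier statement (a displayed Shimura–Heegner point of finite index carrying the depth-`k`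
Euler system: CST14 Thm 1.5 + BD96 §2 + Nekovář 2007 §4 + Kolyvagin on `X_{N⁺,N⁻}`) and `hPT`; no `hTam`,
no `0 < [E(K):ℤP]`. [cite: CaiShuTian2014, Thm. 1.5] [cite: GrossLMS1991, Prop. 2.1 (2)]
[cite: McCallumLMS1991, §1 Theorem (Kolyvagin), Lemma 4.6, Lemma 5.1] [cite: SilvermanAEC2009, Thm. VIII.9.3]
[cite: Kim2022HigherGZ, §2.1 and Thm. 4.3] -/
theorem natCard_primaryComponent_sha_le_of_displayedCarrier_shift_of_poitouTate
    {K : Type} [Field K] [NumberField K]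
    (hPT : poitouTate_sum_localTatePairing_eq_zero K)
    (W : WeierstrassCurve ℚ) [W.IsElliptic] [W.IsGloballyMinimal] {N : ℕ} [NeZero N]
    (hN : W.conductorNorm ℤ = N) {p : ℕ} [Fact p.Prime] (hp5 : 5 ≤ p)
    (hρ : W.HasSurjectiveModNGaloisRep p) (hK : IsImaginaryQuadratic K) (ι : K →+* ℂ)
    (Dt : Literature.NumberTheory.EllipticCurves.ModularForms.ModularParametrizationData W N)
    {S : Finset ℕ}
    (hin : ∀ ℓ ∈ S, ℓ.Prime ∧ ℓ ∣ N ∧ ¬ ℓ ^ 2 ∣ N ∧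
      ((Ideal.span {(ℓ : ℤ)}).primesOver (𝓞 K)).ncard = 1 ∧ ¬ (ℓ : ℤ) ∣ NumberField.discr K)
    (hsp : ∀ ℓ : ℕ, ℓ.Prime → ℓ ∣ N → ℓ ∉ S → ((Ideal.span {(ℓ : ℤ)}).primesOver (𝓞 K)).ncard = 2)
    {P : (W.baseChange K).toAffine.Point} (hnt : ¬ IsOfFinAddOrder P) {degS : ℕ} (h0 : 0 < degS)
    (hL : Literature.NumberTheory.EllipticCurves.LDerivEK W K = 8 * (Real.pi : ℂ) ^ 2 *
      Literature.NumberTheory.EllipticCurves.ModularForms.peterssonProduct (CongruenceSubgroup.Gamma0 N) 2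
        Dt.f Dt.f / ((((NumberField.Units.torsionOrder K : ℝ) / 2) ^ 2 * √|(NumberField.discr K : ℝ)| : ℝ) : ℂ) *
      ((P.canonicalHeight : ℂ) / (degS : ℂ)))
    (hidx : padicValNat p (AddSubgroup.zmultiples P).index = 0)
    {y : (W.baseChange K).toAffine.Point} {degy : ℕ} (h0y : 0 < degy)
    (hvy : padicValNat p degS = padicValNat p degy)
    (hLy : Literature.NumberTheory.EllipticCurves.LDerivEK W K = 8 * (Real.pi : ℂ) ^ 2 *
      Literature.NumberTheory.EllipticCurves.ModularForms.peterssonProduct (CongruenceSubgroup.Gamma0 N) 2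
        Dt.f Dt.f / ((((NumberField.Units.torsionOrder K : ℝ) / 2) ^ 2 * √|(NumberField.discr K : ℝ)| : ℝ) : ℂ) *
      ((y.canonicalHeight : ℂ) / (degy : ℂ)))
    (hidxy : 0 < (AddSubgroup.zmultiples y).index)
    (hpointsRk : ∀ (k : ℕ) {M : ℕ} (_hM : 1 ≤ M)
      (hdiv : ∀ Q : geomPoints (W.baseChange K), ∃ R, ((p ^ M : ℕ) : ℤ) • R = Q)
      (c : K ≃ₐ[ℚ] K) (_hc : c ≠ 1),
      ∃ (ε : ℤ) (τ : AlgebraicClosure K ≃+* AlgebraicClosure K) (hτ : IsLiftOfAut c τ)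
        (A : ℕ → AddSubgroup (geomPoints (W.baseChange K)))
        (hA : ∀ m, KolyvaginCocycle.IsAdmissible (Field.absoluteGaloisGroup K) (A m)
          ((p ^ M : ℕ) : ℤ))
        (emb : ∀ m : ℕ, ringClassField K ι m →ₐ[K] AlgebraicClosure K)
        (Pt : ℕ → geomPoints (W.baseChange K))
        (hPt : ∀ m, Pt m ∈
          KolyvaginCocycle.invPoints (Field.absoluteGaloisGroup K) (A m) ((p ^ M : ℕ) : ℤ)),
        (ε = 1 ∨ ε = -1) ∧
        IsOfFinAddOrder (Affine.Point.map (W' := W) (c : K →ₐ[ℚ] K) y - ε • y) ∧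
        (∀ m, ∀ a ∈ A m, hτ.pointsMap W a ∈ A m) ∧
        Pt 1 = toGeomPoints (W.baseChange K) y ∧
        (∀ m, m ≠ 0 → ∀ a ∈ A m, ∀ Φ : Field.absoluteGaloisGroup K,
          (∀ x : ringClassField K ι m, Φ • emb m x = emb m x) → Φ • a = a) ∧
        (∀ m, KolyvaginCocycle.IsAdmissible (Field.absoluteGaloisGroup K) (A m)
          ((p ^ (M + k) : ℕ) : ℤ)) ∧
        (∀ m : ℕ, Squarefree m →
          (∀ q ∈ m.primeFactors, IsKolyvaginPrime N W K p q ∧ FrobEqFrobInfty W K (p ^ (M + k)) q) →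
          Pt m ∈ KolyvaginCocycle.invPoints (Field.absoluteGaloisGroup K) (A m)
            ((p ^ (M + k) : ℕ) : ℤ) ∧
          (∃ B ∈ A m, hτ.pointsMap W (Pt m) =
            (ε * (-1) ^ m.primeFactors.card) • Pt m + ((p ^ M : ℕ) : ℤ) • B) ∧
          (∀ ℓ : ℕ, ℓ.Prime → ℓ ∣ m → ∀ v : HeightOneSpectrum (𝓞 K), (ℓ : 𝓞 K) ∈ v.asIdeal →
            ∀ a : ℕ, (((p : ℤ) ^ a) •
                kolyvaginClass (W.baseChange K) _ hdiv (hA m) (Pt m) (hPt m) ∈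
                selmerLocalKer (W.baseChange K) (v.adicCompletion K) ((p ^ M : ℕ) : ℤ) ↔
              ((p : ℤ) ^ a) • kolyvaginClass (W.baseChange K) _ hdiv (hA (m / ℓ)) (Pt (m / ℓ))
                  (hPt (m / ℓ)) ∈
                (W.baseChange K).torsionLocalKer (v.adicCompletion K) ((p ^ M : ℕ) : ℤ))))) :
    Nat.card (AddCommGroup.primaryComponent (W.baseChange K).sha p) ≤
      p ^ (2 * padicValNat p (AddSubgroup.zmultiples P).index) := by
  obtain ⟨-, heq⟩ := padicValNat_index_eq_of_displays W Dt K p hnt hidxy h0 h0y hvy hL hLy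
  have hy' : ¬ IsOfFinAddOrder y := not_isOfFinAddOrder_of_index_pos hnt hidxy
  have hidxy0 : padicValNat p (AddSubgroup.zmultiples y).index = 0 := heq ▸ hidx
  rw [heq]
  exact natCard_primaryComponent_sha_le_of_ringClassRationalPointsM_shift_of_poitouTate hPT W hN hp5 hρ
    hK ι hin hsp hy' hidxy hidxy0 hpointsRk

end Summit.BirchSwinnertonDyer.BirchSwinnertonDyer.Theorems

end
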